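import Mathlib
import Summits.Ventures.HodgeRepro.Tier4.Target
import Summits.Ventures.HodgeRepro.Tier4.LitCompactness
import Summits.Ventures.HodgeRepro.Tier4.Line3.Defs
import Summits.Ventures.HodgeRepro.Tier4.Line3.LocaliserS
import Summits.Ventures.HodgeRepro.Tier4.Line3.TorusInvariance
import Summits.Ventures.HodgeRepro.Tier4.Line3.StableLattice
import Summits.Ventures.HodgeRepro.Tier4.Line3.LatticeGaussDefs
import Summits.Ventures.HodgeRepro.Tier4.Line3.InvariantMajorantDef
import Summits.Ventures.HodgeRepro.Tier4.Line3.InvariantClassBound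
import Summits.Ventures.HodgeRepro.Tier4.Line3.InvariantRouteAssembly
import Summits.Ventures.HodgeRepro.Tier4.Line3.OffMainMassAssembly
import Summits.Ventures.HodgeRepro.Tier4.Line3.InvMajorantMass

/-!
# Tier4/Line3/InvariantRouteFinal — L3.5 `term_dominated` from the invariant growth clause and the BHC domain

Blind re-derivation cell `pub-hodge-repro`, Tier 4 «PROVE THE STEP» (README §9–§10), LINE L3, seat t4-L2-p3 (gen 2,
on L3.5 `term_dominated`).  The final composition of the invariant-majorant route (S12951, S13087):

* `isGammaStable_linesOf`: the line tuples of a `Γ`-stable `𝒪`-submodule form a `Γ`-stable set (`IsGammaStable`);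
* `term_dominated_of_growthInv_lit`: **L3.5's conclusion verbatim** from TWO displayed hypotheses only —
  `hinv : GrowthInv D p L₀ xm ℓ` (the invariant growth clause of the localiser, InvariantClassBound) and
  `hlit : Lit.BorelHarishChandra1962_Thm11_8_fundamentalDomain_hdef X.E X.H X.τ₀ X.C` (the relatively compact
  fundamental domain of `Γ`, the skeleton's `hlit`).  Everything else is a theorem of the tree: the `Γ`-stable lattice
  `denomLattice d` containing the support (t4-L2-p1's `StableLattice.exists_stable_lattice_supp`), the theta mass of
  the invariant majorant density on `{nsq ≤ r₀}` (t4-x2's `InvMajorantMass.exists_invMajorantDensity_le_of_nsq_le`),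
  the pointwise bound, the invariance of the density, the cover by coset translates, the index bound and the
  reduction `term_dominated_of_offMainMass` (InvariantRouteAssembly).

No good domain of the level, no archimedean size of coset representatives, no printed input beyond `hlit`.  Nothing
here asserts anything about the truth of (P); HC_CM is NOT proved by anyone in this repository.
-/

set_option autoImplicit false

noncomputable section

namespace Summit.Ventures.HodgeRepro.Tier4.Line3

open Summit.Ventures.HodgeRepro.Tier4
open Matrix MeasureTheory NumberField
open scoped ENNReal

namespace T4Data

variable (X : T4Data)

/-- The line tuples of a `Γ`-stable submodule form a `Γ`-stable set. -/
theorem isGammaStable_linesOf {L' : Submodule (RingOfIntegers X.E) (Fin 3 → X.E)}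
    (hL' : ∀ γ ∈ X.Γ, ∀ v ∈ L', γ *ᵥ v ∈ L') : X.IsGammaStable (X.linesOf L') := by
  rintro γ hγ x ⟨x', hx', hx'L⟩
  obtain ⟨t, ht, hxt⟩ := X.exists_torus_of_lines_eq hx'.symm
  refine ⟨fun j => γ *ᵥ x' j, ?_, fun j => hL' γ hγ _ (hx'L j)⟩
  funext j
  show Quot.mk _ (γ *ᵥ x' j) = Quot.mk _ (γ *ᵥ x j)
  rw [hxt j, Matrix.mulVec_smul]
  exact (Quot.sound ⟨t j, ht j, rfl⟩).symm

/-- The mass of a density bounded by `A` on a measurable subset of the ball is at most `A · vol(𝔹)`. -/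
theorem lintegral_le_of_le_on {F : Set (Fin 2 → ℂ)} (hFm : MeasurableSet F) (hFb : F ⊆ ball)
    {μ : (Fin 2 → ℂ) → ℝ≥0∞} {A : ℝ} (hA : 0 ≤ A) (hμ : ∀ z ∈ F, μ z ≤ ENNReal.ofReal A) :
    ∫⁻ z in F, μ z ≤ ENNReal.ofReal (A * (volume (ball : Set (Fin 2 → ℂ))).toReal) := by
  have hvol : volume (ball : Set (Fin 2 → ℂ)) ≠ ⊤ := volume_ball_ne_top
  calc ∫⁻ z in F, μ z ≤ ∫⁻ _ in F, ENNReal.ofReal A :=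
        lintegral_mono_ae ((ae_restrict_iff' hFm).mpr (Filter.Eventually.of_forall hμ))
    _ = ENNReal.ofReal A * volume F := setLIntegral_const _ _
    _ ≤ ENNReal.ofReal A * volume (ball : Set (Fin 2 → ℂ)) := mul_le_mul_right (measure_mono hFb) _
    _ = ENNReal.ofReal (A * (volume (ball : Set (Fin 2 → ℂ))).toReal) := by
        rw [ENNReal.ofReal_mul hA, ENNReal.ofReal_toReal hvol]

/-- **L3.5 FROM THE INVARIANT GROWTH CLAUSE AND THE BHC DOMAIN** — `term_dominated`'s conclusion verbatim, with
`hinv` (the interface clause of the localiser) and `hlit` (the skeleton's printed input) as the only displayed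
hypotheses. -/
theorem term_dominated_of_growthInv_lit (D : X.ThetaData)
    (p : IsDedekindDomain.HeightOneSpectrum (RingOfIntegers X.E))
    (L₀ : Submodule (RingOfIntegers X.E) (Fin 3 → X.E)) (xm : X.Tuple)
    (h02 : xm 2 = xm 0) (h13 : xm 3 = xm 1) (hab : LinearIndependent X.E ![xm 0, xm 1]) (ℓ : X.LocS D p L₀ xm)
    (hinv : X.GrowthInv D p L₀ xm ℓ)
    (hlit : Lit.BorelHarishChandra1962_Thm11_8_fundamentalDomain_hdef X.E X.H X.τ₀ X.C) :
    ∃ bound : X.Orbit → ℝ, (∀ o, 0 ≤ bound o) ∧ Summable bound ∧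
      ∀ N (o : X.Orbit), o ≠ X.orbitOf (X.lines xm) →
        ‖X.term D.Φ D.cf (ℓ.level N) (ℓ.loc N) o‖ ≤ bound o := by
  -- the relatively compact fundamental domain of `Γ`
  obtain ⟨F, hF, r₀, hr₀, hFr⟩ := hlit X.hHerm X.hAn X.hC X.hDef X.Γ X.hΓ
  -- the `Γ`-stable lattice containing the support
  obtain ⟨d, hd, _, hxm, hstab, hsupp⟩ := X.exists_stable_lattice_supp D ℓ
  have hS : X.IsGammaStable (X.linesOf (X.denomLattice d)) := X.isGammaStable_linesOf hstab
  have hsupp' : X.SupportIn D p L₀ xm ℓ (X.linesOf (X.denomLattice d)) := by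
    intro N w hc
    obtain ⟨x, hx, hxL⟩ := hsupp N w hc
    refine ⟨x, hx, fun j => ?_⟩
    have h1 : x j - xm j ∈ X.denomLattice d := Submodule.smul_le_right (hxL j)
    have h3 : x j = (x j - xm j) + xm j := by ring
    rw [h3]
    exact (X.denomLattice d).add_mem h1 (hxm j)
  -- the theta mass of the invariant majorant over `F`
  have hmass : ∀ e c₁ : ℝ, 0 < c₁ → ∃ M_F : ℝ, 0 ≤ M_F ∧
      ∫⁻ z in F, X.invMajorantDensity D (X.linesOf (X.denomLattice d)) xm e c₁ z ≤ ENNReal.ofReal M_F := by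
    intro e c₁ hc₁
    obtain ⟨A, hA, hbound⟩ := X.exists_invMajorantDensity_le_of_nsq_le D p hd xm e hc₁ hr₀
    refine ⟨A * (volume (ball : Set (Fin 2 → ℂ))).toReal, mul_nonneg hA ENNReal.toReal_nonneg, ?_⟩
    exact lintegral_le_of_le_on hF.1 hF.2.1 hA fun z hz => hbound z (hFr z hz)
  exact X.term_dominated_of_growthInv D p L₀ xm h02 h13 hab ℓ hinv hS hsupp' hF hmass

end T4Data

end Summit.Ventures.HodgeRepro.Tier4.Line3

end
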